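import Mathlib.Algebra.Algebra.Operations
import Mathlib.LinearAlgebra.Span.Defs
import Mathlib.LinearAlgebra.LinearIndependent.Basic
import Mathlib.RingTheory.AdjoinRoot
import Mathlib.Tactic.ComputeDegree
import HarnessLib

/-!
# Hertling–Larabi 2026b LEMMA 8.1: in the cubic number field of Dade–Taussky–Zassenhaus (`β³ + 2β² + 2β + 2 = 0`) the
# only orders between `Λ_4 = ℤ[2β] = ⟨1, 2β, 4β²⟩_ℤ` and `Λ_1 = ℤ[β] = ⟨1, β, β²⟩_ℤ` are
# `Λ_1, Λ_2 = ⟨1, 2β, β²⟩_ℤ, Λ_3 = ⟨1, 2β, 2β²⟩_ℤ, Λ_4`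

[topic NumberTheory/ComplexMultiplication] General-`A` lattice series of Hertling–Larabi (namespace
`Literature.NumberTheory.ComplexMultiplication.FiniteQAlgebraLattice`), the worked example of §8 «An irreducible
rank 3 case» (the example of [DTZ62]).  Lane `lit-hodgefound` (Track 2 foundations library), seat p19 generation 41,
rows g41-#4 (§§1–5) and g41-#5 (§§6–9: the data HL compute after Lemma 8.1 — `L_3`, `𝒪(L_3) = Λ_3`, `L_3² = Λ_1`,
the unit `β + 1` in the four orders, the conductors `C_2, C_3, C_4`, the lattice `L_4` of (8.2) with `𝒪(L_4) = Λ_4`,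
and the six printed matrices).  THEOREMS ONLY: no definition, no instance, no notation, no named fact (D-0026, net Literature debt `0`),
no `sorry`.

DEF-FREE SPELLING.  `A` is any commutative ring with an element `β` satisfying `β³ + 2β² + 2β + 2 = 0` (§§1–4: the
classification needs nothing else); the four lattices are the `ℤ`-spans `span ℤ {1, β, β²}`, `span ℤ {1, 2β, β²}`,
`span ℤ {1, 2β, 2β²}`, `span ℤ {1, 2β, 4β²}`; «order» = `ℤ`-submodule `Λ` with `1 ∈ Λ` and `Λ·Λ ⊆ Λ`.  HL take from
[LMFDB23] (without proof) that `Λ_1 = ℤ[β]` is the maximal order `Λ_max` of `A = ℚ(β)`, so that every order lies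
in `Λ_1`; accordingly the containment `Λ ⊆ Λ_1` is a HYPOTHESIS here, and Lemma 8.1 is proved in the form «the
orders `Λ` with `Λ_4 ⊆ Λ ⊆ Λ_1` are exactly `Λ_1, Λ_2, Λ_3, Λ_4`».  §3 adds that the four are different when
`1, β, β²` are `ℤ`-linearly independent, and §5 instantiates everything in `A = ℚ[t]/(t³ + 2t² + 2t + 2)`
(`AdjoinRoot`), where `1, β, β²` is the power basis.

## Source, VERBATIM

C. Hertling, K. Larabi, *Conjugacy classes of regular integer matrices*, arXiv:2602.15748 (2026)
[HertlingLarabi2026b], held `paper:arxiv-2602.15748`, §8, chunk p0024: «Dade, Taussky and Zassenhaus report in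
[DTZ62] that they calculated with computer for some algebraic number fields `A` and orders `Λ_4 ⊂ A` the finite
subsemigroup `{[L]_w | L ∈ 𝓛(A), 𝒪(L) ⊃ Λ_4}` […] In [DTZ62] they document one example. There `A = ℚ[α]` with `α` a
zero of the irreducible polynomial `t³ + 4t² + 8t + 16` and `Λ_4 = ℤ[α] ⊂ A`. […] First, we cite (and use without
own proof) some facts which [LMFDB23] states on the algebraic number field `A := ℚ[α]` and its maximal order
`Λ_max` of algebraic integers: `A = ℚ[γ]` where `γ` is a zero of `t³ − t² + t + 1`, `Λ_max = ℤ[γ] = ⟨1, γ, γ²⟩_ℤ`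
[…]. Define `β := γ − 1`. Then `0 = β³ + 2β² + 2β + 2`, `α = 2β`, `Λ_1 := Λ_max = ℤ[β] = ⟨1, β, β²⟩_ℤ`, […]
`Λ_4 = ℤ[2β] = ⟨1, 2β, 4β²⟩_ℤ`. **Lemma 8.1.** The only orders `Λ ⊃ Λ_4` are `Λ_1 = ⟨1, β, β²⟩_ℤ`,
`Λ_2 = ⟨1, 2β, β²⟩_ℤ`, `Λ_3 = ⟨1, 2β, 2β²⟩_ℤ`, `Λ_4 = ⟨1, 2β, 4β²⟩_ℤ`. **Proof:** Let `Λ ⊃ Λ_4` be an order.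
First case, `Λ ∩ {β + lβ² | l ∈ ℤ} = ∅`: Then `Λ = ⟨1, 2β⟩_ℤ + Λ ∩ ℤβ²` and `Λ ∩ ℤβ² ⊃ ℤ4β²`. Only `Λ_2, Λ_3` and
`Λ_4` are possible. Second case, for some `l ∈ ℤ` we have `β + lβ² ∈ Λ`: Because `4β² ∈ Λ_4 ⊂ Λ` we can suppose
`l ∈ {0, 1, 2, 3}`. We will show in each case `Λ = Λ_1`. `l = 0`: `β² ∈ Λ`, `Λ = Λ_1`. `l = 1`:
`(β + β²)² = β² + 2β³ + β⁴ = −2β − β² = −β − (β + β²)`, so `β ∈ Λ`, so `Λ = Λ_1`. `l = 2`: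
`(β + 2β²)² = β² + 4β³ + 4β⁴ = β² + 8`, so `β² ∈ Λ`, so `β ∈ Λ`, so `Λ = Λ_1`. `l = 3`:
`β + 3β² = −(β + β²) + 2β + 4β²`, so `β + β² ∈ Λ`, so `Λ = Λ_1`. □»

## What is proved (`A` a commutative ring, `β : A` with `β³ + 2β² + 2β + 2 = 0`)

* §1 arithmetic in `ℤ[β]`: `pow_three_eq`, `pow_four_eq`, and the three identities of the proof:
  `sq_add_sq_eq` (`(β + β²)² = −2β − β²`), `sq_add_two_sq_eq` (`(β + 2β²)² = β² + 8`),
  `add_three_sq_eq` (`β + 3β² = −(β + β²) + 2β + 4β²`).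
* §2 the four lattices are orders between `Λ_4` and `Λ_1`: `one_mem_spanᵢ`, `span₁_mul_le` … `span₄_mul_le`
  (multiplicatively closed), `span₄_le_span₃`, `span₃_le_span₂`, `span₂_le_span₁`.
* §3 (under `ℤ`-linear independence of `1, β, β²`) coordinates: `mem_span₂_iff` (`u + vβ + wβ² ∈ Λ_2 ⟺ 2 ∣ v`),
  `mem_span₃_iff` (`⟺ 2 ∣ v ∧ 2 ∣ w`), `mem_span₄_iff` (`⟺ 2 ∣ v ∧ 4 ∣ w`), and `span_ne` (the four are pairwise
  different).
* §4 **LEMMA 8.1** `eq_of_isOrder_of_le_of_le`: an order `Λ` (here: `Λ·Λ ⊆ Λ`; `1 ∈ Λ` is automatic) with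
  `Λ_4 ⊆ Λ ⊆ Λ_1` is one of `Λ_1, Λ_2, Λ_3, Λ_4` — HL's case distinction verbatim (`β + lβ² ∈ Λ`, `l mod 4`).
* §5 the field of [DTZ62]: in `A = ℚ[t]/(t³ + 2t² + 2t + 2)` the class `β = [t]` satisfies the relation and
  `1, β, β²` are `ℤ`-linearly independent (`linearIndependent_powers_root`), so §§3–4 apply verbatim
  (`eq_of_isOrder_adjoinRoot`).
* §6 (row g41-#5) `coords_mul_root`, `coords_mul_sq` (coordinates of `xβ`, `xβ²`), the lattice `L_3 = ⟨1, β, 2β²⟩`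
  of (8.1): `mem_spanL₃_iff` (`⟺ 2 ∣ w`), **`spanL₃_mul_spanL₃`** (`L_3² = Λ_1`), `spanL₃_ne_span₁` (`L_3 ⊊ Λ_1`, so
  `L_3` is not invertible by Dedekind's Lemma 4.6 — the lemma itself is not restated here), **`spanL₃_div_spanL₃`**
  (`𝒪(L_3) = L_3 : L_3 = Λ_3`, «One sees easily `𝒪(L_3) = Λ_3`»).
* §7 (row g41-#5) the unit `β + 1`: `add_one_mul_eq_one`, `add_one_sq`, `add_one_pow_three`, **`add_one_pow_four`**
  (`(β+1)⁴ = −2β − 3`), `pow_four_mul_inv_eq_one`, and **`add_one_pow_mem_span₂_iff`** (`(β+1)ᵏ ∈ Λ_2 ⟺ 2 ∣ k`),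
  `add_one_pow_mem_span₃_iff`, `add_one_pow_mem_span₄_iff` (`⟺ 4 ∣ k`) — the membership half of
  «`Λ_2^{unit} = {±(β+1)^{2l}}`, `Λ_3^{unit} = Λ_4^{unit} = {±(β+1)^{4l}}`» (that `Λ_1^{unit} = ±(β+1)^ℤ` is HL's
  citation of [LMFDB23]).
* §8 (row g41-#5) the conductors: **`span₂_div_span₁`** (`C_2 = Λ_2 : Λ_1 = ⟨2, 2β, β²⟩`), `span₃_div_span₁`
  (`C_3 = ⟨2, 2β, 2β²⟩`), `span₄_div_span₁` (`C_4 = ⟨4, 4β, 4β²⟩`).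
* §9 (row g41-#5) `L_4 = ⟨2, 2β, 2β² + 1⟩` of (8.2): `mem_spanL₄_iff`, **`spanL₄_div_spanL₄`** (`𝒪(L_4) = Λ_4`),
  `span_C₄_sup_eq_spanL₄` ((8.2): `L_4 = C_4 + (1 + 2β²)Λ_4`), `two_mul_root_mul_basis` (the six printed matrices
  `M_L` are the matrices of `2β` in the six bases) and `charpoly_six_matrices` (each has `χ = t³ + 4t² + 8t + 16`).
NOT here: `Λ_1 = Λ_max` and `Λ_1^{unit} = ±(β+1)^ℤ` (cited by HL from [LMFDB23]); the `w`-class counts `τᵢ`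
(Thm. 5.7), `|G([Λᵢ]_ε)|` (Thm. 5.12), the completeness of the six `ε`-classes and their non-conjugacy, Lemma 8.2
and the multiplication/division tables.

## References
* [HertlingLarabi2026b] C. Hertling, K. Larabi, arXiv:2602.15748 (2026), §8 Lemma 8.1 with proof (chunk p0024).
  [cite: HertlingLarabi2026b, §8 Lemma 8.1, chunk p0024]
* [DadeTausskyZassenhaus1962] E. C. Dade, O. Taussky, H. Zassenhaus, *On the theory of orders …*, Math. Ann. 148
  (1962) 31–64 (the example, as reported by HL §8; source not held).
-/

open Submodule

namespace Literature.NumberTheory.ComplexMultiplication.FiniteQAlgebraLattice.DTZCubic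

variable {A : Type*} [CommRing A] {β : A}

/-! ## §1 Arithmetic in `ℤ[β]`, `β³ + 2β² + 2β + 2 = 0` -/

/-- `β³ = −2β² − 2β − 2`. [cite: HertlingLarabi2026b, §8 («`0 = β³ + 2β² + 2β + 2`»), chunk p0024] -/
theorem pow_three_eq (hβ : β ^ 3 + 2 * β ^ 2 + 2 * β + 2 = 0) : β ^ 3 = -2 * β ^ 2 - 2 * β - 2 := by
  linear_combination hβ

/-- `β⁴ = 2β² + 2β + 4`. [cite: HertlingLarabi2026b, §8 proof of Lemma 8.1, chunk p0024] -/
theorem pow_four_eq (hβ : β ^ 3 + 2 * β ^ 2 + 2 * β + 2 = 0) : β ^ 4 = 2 * β ^ 2 + 2 * β + 4 := by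
  linear_combination (β - 2) * hβ

/-- «`(β + β²)² = β² + 2β³ + β⁴ = −2β − β²`». [cite: HertlingLarabi2026b, §8 proof of Lemma 8.1 (`l = 1`), chunk p0024] -/
theorem sq_add_sq_eq (hβ : β ^ 3 + 2 * β ^ 2 + 2 * β + 2 = 0) : (β + β ^ 2) ^ 2 = -2 * β - β ^ 2 := by
  linear_combination β * hβ

/-- «`(β + 2β²)² = β² + 4β³ + 4β⁴ = β² + 8`». [cite: HertlingLarabi2026b, §8 proof of Lemma 8.1 (`l = 2`), chunk p0024] -/
theorem sq_add_two_sq_eq (hβ : β ^ 3 + 2 * β ^ 2 + 2 * β + 2 = 0) : (β + 2 * β ^ 2) ^ 2 = β ^ 2 + 8 := by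
  linear_combination (4 * β - 4) * hβ

/-- «`β + 3β² = −(β + β²) + 2β + 4β²`». [cite: HertlingLarabi2026b, §8 proof of Lemma 8.1 (`l = 3`), chunk p0024] -/
theorem add_three_sq_eq (β : A) : β + 3 * β ^ 2 = -(β + β ^ 2) + 2 * β + 4 * β ^ 2 := by
  ring

/-! ## §2 The four lattices `Λ_1 ⊇ Λ_2 ⊇ Λ_3 ⊇ Λ_4` are orders -/

/-- A `ℤ`-span of three elements of a commutative ring is multiplicatively closed as soon as the six products of
the generators lie in it. [folklore] -/
private theorem span_triple_mul_le {p q r : A}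
    (hpp : p * p ∈ span ℤ ({p, q, r} : Set A)) (hpq : p * q ∈ span ℤ ({p, q, r} : Set A))
    (hpr : p * r ∈ span ℤ ({p, q, r} : Set A)) (hqq : q * q ∈ span ℤ ({p, q, r} : Set A))
    (hqr : q * r ∈ span ℤ ({p, q, r} : Set A)) (hrr : r * r ∈ span ℤ ({p, q, r} : Set A)) :
    span ℤ ({p, q, r} : Set A) * span ℤ ({p, q, r} : Set A) ≤ span ℤ ({p, q, r} : Set A) := by
  rw [span_mul_span, span_le]
  rintro x ⟨a, ha, b, hb, rfl⟩
  show a * b ∈ (span ℤ ({p, q, r} : Set A) : Set A)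
  simp only [Set.mem_insert_iff, Set.mem_singleton_iff] at ha hb
  rcases ha with rfl | rfl | rfl <;> rcases hb with rfl | rfl | rfl <;>
    first | assumption | (rw [mul_comm]; assumption)

/-- `1 ∈ Λ_1 = ⟨1, β, β²⟩`. [cite: HertlingLarabi2026b, §8 Lemma 8.1, chunk p0024] -/
theorem one_mem_span₁ (β : A) : (1 : A) ∈ span ℤ ({1, β, β ^ 2} : Set A) := subset_span (by simp)

/-- `1 ∈ Λ_2 = ⟨1, 2β, β²⟩`. [cite: HertlingLarabi2026b, §8 Lemma 8.1, chunk p0024] -/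
theorem one_mem_span₂ (β : A) : (1 : A) ∈ span ℤ ({1, 2 * β, β ^ 2} : Set A) := subset_span (by simp)

/-- `1 ∈ Λ_3 = ⟨1, 2β, 2β²⟩`. [cite: HertlingLarabi2026b, §8 Lemma 8.1, chunk p0024] -/
theorem one_mem_span₃ (β : A) : (1 : A) ∈ span ℤ ({1, 2 * β, 2 * β ^ 2} : Set A) := subset_span (by simp)

/-- `1 ∈ Λ_4 = ⟨1, 2β, 4β²⟩`. [cite: HertlingLarabi2026b, §8 Lemma 8.1, chunk p0024] -/
theorem one_mem_span₄ (β : A) : (1 : A) ∈ span ℤ ({1, 2 * β, 4 * β ^ 2} : Set A) := subset_span (by simp)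

/-- Membership of an explicit `ℤ`-combination in a span of three elements. [folklore] -/
private theorem mem_span_triple_of_eq {p q r x : A} (a b c : ℤ) (h : (a : A) * p + b * q + c * r = x) :
    x ∈ span ℤ ({p, q, r} : Set A) :=
  mem_span_triple.2 ⟨a, b, c, by simpa only [zsmul_eq_mul] using h⟩

/-- **`Λ_1 = ℤ[β]` is an order** (multiplicatively closed). [cite: HertlingLarabi2026b, §8 («`Λ_1 := Λ_max = ℤ[β] = ⟨1, β, β²⟩_ℤ`»), chunk p0024] -/
theorem span₁_mul_le (hβ : β ^ 3 + 2 * β ^ 2 + 2 * β + 2 = 0) :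
    span ℤ ({1, β, β ^ 2} : Set A) * span ℤ ({1, β, β ^ 2} : Set A) ≤ span ℤ ({1, β, β ^ 2} : Set A) := by
  refine span_triple_mul_le ?_ ?_ ?_ ?_ ?_ ?_
  · exact mem_span_triple_of_eq 1 0 0 (by push_cast; ring)
  · exact mem_span_triple_of_eq 0 1 0 (by push_cast; ring)
  · exact mem_span_triple_of_eq 0 0 1 (by push_cast; ring)
  · exact mem_span_triple_of_eq 0 0 1 (by push_cast; ring)
  · exact mem_span_triple_of_eq (-2) (-2) (-2) (by push_cast; linear_combination -hβ)
  · exact mem_span_triple_of_eq 4 2 2 (by push_cast; linear_combination -(β - 2) * hβ)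

/-- **`Λ_2 = ⟨1, 2β, β²⟩` is an order.** [cite: HertlingLarabi2026b, §8 Lemma 8.1, chunk p0024] -/
theorem span₂_mul_le (hβ : β ^ 3 + 2 * β ^ 2 + 2 * β + 2 = 0) :
    span ℤ ({1, 2 * β, β ^ 2} : Set A) * span ℤ ({1, 2 * β, β ^ 2} : Set A) ≤
      span ℤ ({1, 2 * β, β ^ 2} : Set A) := by
  refine span_triple_mul_le ?_ ?_ ?_ ?_ ?_ ?_
  · exact mem_span_triple_of_eq 1 0 0 (by push_cast; ring)
  · exact mem_span_triple_of_eq 0 1 0 (by push_cast; ring)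
  · exact mem_span_triple_of_eq 0 0 1 (by push_cast; ring)
  · exact mem_span_triple_of_eq 0 0 4 (by push_cast; ring)
  · exact mem_span_triple_of_eq (-4) (-2) (-4) (by push_cast; linear_combination -2 * hβ)
  · exact mem_span_triple_of_eq 4 1 2 (by push_cast; linear_combination -(β - 2) * hβ)

/-- **`Λ_3 = ⟨1, 2β, 2β²⟩` is an order.** [cite: HertlingLarabi2026b, §8 Lemma 8.1, chunk p0024] -/
theorem span₃_mul_le (hβ : β ^ 3 + 2 * β ^ 2 + 2 * β + 2 = 0) :
    span ℤ ({1, 2 * β, 2 * β ^ 2} : Set A) * span ℤ ({1, 2 * β, 2 * β ^ 2} : Set A) ≤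
      span ℤ ({1, 2 * β, 2 * β ^ 2} : Set A) := by
  refine span_triple_mul_le ?_ ?_ ?_ ?_ ?_ ?_
  · exact mem_span_triple_of_eq 1 0 0 (by push_cast; ring)
  · exact mem_span_triple_of_eq 0 1 0 (by push_cast; ring)
  · exact mem_span_triple_of_eq 0 0 1 (by push_cast; ring)
  · exact mem_span_triple_of_eq 0 0 2 (by push_cast; ring)
  · exact mem_span_triple_of_eq (-8) (-4) (-4) (by push_cast; linear_combination -4 * hβ)
  · exact mem_span_triple_of_eq 16 4 4 (by push_cast; linear_combination -4 * (β - 2) * hβ)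

/-- **`Λ_4 = ℤ[2β] = ⟨1, 2β, 4β²⟩` is an order.** [cite: HertlingLarabi2026b, §8 («`Λ_4 = ℤ[2β] = ⟨1, 2β, 4β²⟩_ℤ`»), chunk p0024] -/
theorem span₄_mul_le (hβ : β ^ 3 + 2 * β ^ 2 + 2 * β + 2 = 0) :
    span ℤ ({1, 2 * β, 4 * β ^ 2} : Set A) * span ℤ ({1, 2 * β, 4 * β ^ 2} : Set A) ≤
      span ℤ ({1, 2 * β, 4 * β ^ 2} : Set A) := by
  refine span_triple_mul_le ?_ ?_ ?_ ?_ ?_ ?_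
  · exact mem_span_triple_of_eq 1 0 0 (by push_cast; ring)
  · exact mem_span_triple_of_eq 0 1 0 (by push_cast; ring)
  · exact mem_span_triple_of_eq 0 0 1 (by push_cast; ring)
  · exact mem_span_triple_of_eq 0 0 1 (by push_cast; ring)
  · exact mem_span_triple_of_eq (-16) (-8) (-4) (by push_cast; linear_combination -8 * hβ)
  · exact mem_span_triple_of_eq 64 16 8 (by push_cast; linear_combination -16 * (β - 2) * hβ)

/-- `Λ_4 ⊆ Λ_3`. [cite: HertlingLarabi2026b, §8 Lemma 8.1, chunk p0024] -/
theorem span₄_le_span₃ (β : A) :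
    span ℤ ({1, 2 * β, 4 * β ^ 2} : Set A) ≤ span ℤ ({1, 2 * β, 2 * β ^ 2} : Set A) := by
  refine span_le.2 ?_
  rintro x (rfl | rfl | rfl)
  · exact subset_span (by simp)
  · exact subset_span (by simp)
  · exact mem_span_triple_of_eq 0 0 2 (by push_cast; ring)

/-- `Λ_3 ⊆ Λ_2`. [cite: HertlingLarabi2026b, §8 Lemma 8.1, chunk p0024] -/
theorem span₃_le_span₂ (β : A) :
    span ℤ ({1, 2 * β, 2 * β ^ 2} : Set A) ≤ span ℤ ({1, 2 * β, β ^ 2} : Set A) := by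
  refine span_le.2 ?_
  rintro x (rfl | rfl | rfl)
  · exact subset_span (by simp)
  · exact subset_span (by simp)
  · exact mem_span_triple_of_eq 0 0 2 (by push_cast; ring)

/-- `Λ_2 ⊆ Λ_1`. [cite: HertlingLarabi2026b, §8 Lemma 8.1, chunk p0024] -/
theorem span₂_le_span₁ (β : A) :
    span ℤ ({1, 2 * β, β ^ 2} : Set A) ≤ span ℤ ({1, β, β ^ 2} : Set A) := by
  refine span_le.2 ?_
  rintro x (rfl | rfl | rfl)
  · exact subset_span (by simp)
  · exact mem_span_triple_of_eq 0 2 0 (by push_cast; ring)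
  · exact subset_span (by simp)

/-! ## §3 Coordinates (under `ℤ`-linear independence of `1, β, β²`): membership criteria, the four are different -/

/-- Coefficient comparison. [folklore] -/
private theorem coeff_eq_zero (hli : LinearIndependent ℤ ![(1 : A), β, β ^ 2]) {a b c : ℤ}
    (h : (a : A) + b * β + c * β ^ 2 = 0) : a = 0 ∧ b = 0 ∧ c = 0 := by
  have H := Fintype.linearIndependent_iff.1 hli ![a, b, c] (by
    simpa [Fin.sum_univ_three, zsmul_eq_mul] using h)
  exact ⟨by simpa using H 0, by simpa using H 1, by simpa using H 2⟩

/-- `u + vβ + wβ² ∈ Λ_2 = ⟨1, 2β, β²⟩ ⟺ 2 ∣ v` (`u, v, w ∈ ℤ`). [cite: HertlingLarabi2026b, §8 Lemma 8.1, chunk p0024] -/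
theorem mem_span₂_iff (hli : LinearIndependent ℤ ![(1 : A), β, β ^ 2]) (u v w : ℤ) :
    (u : A) + v * β + w * β ^ 2 ∈ span ℤ ({1, 2 * β, β ^ 2} : Set A) ↔ 2 ∣ v := by
  constructor
  · intro h
    obtain ⟨a, b, c, habc⟩ := mem_span_triple.1 h
    simp only [zsmul_eq_mul, mul_one] at habc
    obtain ⟨-, h2, -⟩ := coeff_eq_zero hli (a := a - u) (b := 2 * b - v) (c := c - w)
      (by push_cast; linear_combination habc)
    exact ⟨b, by omega⟩
  · rintro ⟨k, rfl⟩
    exact mem_span_triple_of_eq u k w (by push_cast; ring)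

/-- `u + vβ + wβ² ∈ Λ_3 = ⟨1, 2β, 2β²⟩ ⟺ 2 ∣ v ∧ 2 ∣ w`. [cite: HertlingLarabi2026b, §8 Lemma 8.1, chunk p0024] -/
theorem mem_span₃_iff (hli : LinearIndependent ℤ ![(1 : A), β, β ^ 2]) (u v w : ℤ) :
    (u : A) + v * β + w * β ^ 2 ∈ span ℤ ({1, 2 * β, 2 * β ^ 2} : Set A) ↔ 2 ∣ v ∧ 2 ∣ w := by
  constructor
  · intro h
    obtain ⟨a, b, c, habc⟩ := mem_span_triple.1 h
    simp only [zsmul_eq_mul, mul_one] at habc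
    obtain ⟨-, h2, h3⟩ := coeff_eq_zero hli (a := a - u) (b := 2 * b - v) (c := 2 * c - w)
      (by push_cast; linear_combination habc)
    exact ⟨⟨b, by omega⟩, ⟨c, by omega⟩⟩
  · rintro ⟨⟨k, rfl⟩, ⟨m, rfl⟩⟩
    exact mem_span_triple_of_eq u k m (by push_cast; ring)

/-- `u + vβ + wβ² ∈ Λ_4 = ⟨1, 2β, 4β²⟩ ⟺ 2 ∣ v ∧ 4 ∣ w`. [cite: HertlingLarabi2026b, §8 Lemma 8.1, chunk p0024] -/
theorem mem_span₄_iff (hli : LinearIndependent ℤ ![(1 : A), β, β ^ 2]) (u v w : ℤ) :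
    (u : A) + v * β + w * β ^ 2 ∈ span ℤ ({1, 2 * β, 4 * β ^ 2} : Set A) ↔ 2 ∣ v ∧ 4 ∣ w := by
  constructor
  · intro h
    obtain ⟨a, b, c, habc⟩ := mem_span_triple.1 h
    simp only [zsmul_eq_mul, mul_one] at habc
    obtain ⟨-, h2, h3⟩ := coeff_eq_zero hli (a := a - u) (b := 2 * b - v) (c := 4 * c - w)
      (by push_cast; linear_combination habc)
    exact ⟨⟨b, by omega⟩, ⟨c, by omega⟩⟩
  · rintro ⟨⟨k, rfl⟩, ⟨m, rfl⟩⟩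
    exact mem_span_triple_of_eq u k m (by push_cast; ring)

/-- **The four orders are pairwise different** (when `1, β, β²` are `ℤ`-linearly independent): `β ∈ Λ_1 ∖ Λ_2`,
`β² ∈ Λ_2 ∖ Λ_3`, `2β² ∈ Λ_3 ∖ Λ_4`. [cite: HertlingLarabi2026b, §8 Lemma 8.1, chunk p0024] -/
theorem span_ne (hli : LinearIndependent ℤ ![(1 : A), β, β ^ 2]) :
    span ℤ ({1, β, β ^ 2} : Set A) ≠ span ℤ ({1, 2 * β, β ^ 2} : Set A) ∧
      span ℤ ({1, 2 * β, β ^ 2} : Set A) ≠ span ℤ ({1, 2 * β, 2 * β ^ 2} : Set A) ∧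
      span ℤ ({1, 2 * β, 2 * β ^ 2} : Set A) ≠ span ℤ ({1, 2 * β, 4 * β ^ 2} : Set A) ∧
      span ℤ ({1, β, β ^ 2} : Set A) ≠ span ℤ ({1, 2 * β, 4 * β ^ 2} : Set A) := by
  have hβ₁ : β ∈ span ℤ ({1, β, β ^ 2} : Set A) := subset_span (by simp)
  have hβ₂ : β ∉ span ℤ ({1, 2 * β, β ^ 2} : Set A) := fun h => by
    have := (mem_span₂_iff hli 0 1 0).1 (by simpa using h)
    omega
  have hβ₄ : β ∉ span ℤ ({1, 2 * β, 4 * β ^ 2} : Set A) := fun h => hβ₂ (span₃_le_span₂ β (span₄_le_span₃ β h))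
  have hsq₂ : β ^ 2 ∈ span ℤ ({1, 2 * β, β ^ 2} : Set A) := subset_span (by simp)
  have hsq₃ : β ^ 2 ∉ span ℤ ({1, 2 * β, 2 * β ^ 2} : Set A) := fun h => by
    have := (mem_span₃_iff hli 0 0 1).1 (by simpa using h)
    omega
  have h2sq₃ : 2 * β ^ 2 ∈ span ℤ ({1, 2 * β, 2 * β ^ 2} : Set A) := subset_span (by simp)
  have h2sq₄ : 2 * β ^ 2 ∉ span ℤ ({1, 2 * β, 4 * β ^ 2} : Set A) := fun h => by
    have := (mem_span₄_iff hli 0 0 2).1 (by simpa using h)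
    omega
  exact ⟨fun e => hβ₂ (e ▸ hβ₁), fun e => hsq₃ (e ▸ hsq₂), fun e => h2sq₄ (e ▸ h2sq₃), fun e => hβ₄ (e ▸ hβ₁)⟩

/-! ## §4 LEMMA 8.1: the orders between `Λ_4` and `Λ_1` -/

/-- **LEMMA 8.1** (with `Λ ⊆ Λ_1 = Λ_max` as a hypothesis, see the module docstring): a multiplicatively closed
`ℤ`-submodule `Λ` with `⟨1, 2β, 4β²⟩ ⊆ Λ ⊆ ⟨1, β, β²⟩` is one of `⟨1, β, β²⟩`, `⟨1, 2β, β²⟩`, `⟨1, 2β, 2β²⟩`,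
`⟨1, 2β, 4β²⟩` — HL's proof: either some `β + lβ² ∈ Λ` (`l ∈ {0, 1, 2, 3}` after `4β² ∈ Λ`), and then the
identities of §1 give `β, β² ∈ Λ`, `Λ = Λ_1`; or `Λ = ⟨1, 2β⟩ + Λ ∩ ℤβ²` with `Λ ∩ ℤβ² ∈ {ℤβ², 2ℤβ², 4ℤβ²}`.
[cite: HertlingLarabi2026b, §8 Lemma 8.1 with proof, chunk p0024] -/
theorem eq_of_isOrder_of_le_of_le (hβ : β ^ 3 + 2 * β ^ 2 + 2 * β + 2 = 0) {Λ : Submodule ℤ A}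
    (h₄ : span ℤ ({1, 2 * β, 4 * β ^ 2} : Set A) ≤ Λ) (h₁ : Λ ≤ span ℤ ({1, β, β ^ 2} : Set A))
    (hmul : Λ * Λ ≤ Λ) :
    Λ = span ℤ ({1, β, β ^ 2} : Set A) ∨ Λ = span ℤ ({1, 2 * β, β ^ 2} : Set A) ∨
      Λ = span ℤ ({1, 2 * β, 2 * β ^ 2} : Set A) ∨ Λ = span ℤ ({1, 2 * β, 4 * β ^ 2} : Set A) := by
  -- basic members and closure properties
  have m1 : (1 : A) ∈ Λ := h₄ (subset_span (by simp))
  have m2β : 2 * β ∈ Λ := h₄ (subset_span (by simp))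
  have m4sq : 4 * β ^ 2 ∈ Λ := h₄ (subset_span (by simp))
  have zmul : ∀ (n : ℤ) {x : A}, x ∈ Λ → (n : A) * x ∈ Λ := fun n x hx => by
    simpa only [zsmul_eq_mul] using Λ.smul_mem n hx
  have mmul : ∀ {x y : A}, x ∈ Λ → y ∈ Λ → x * y ∈ Λ := fun hx hy => hmul (mul_mem_mul hx hy)
  -- the reduction `u + vβ + wβ² ∈ Λ ⟹ (v − 2k)β + (w − 4m)β² ∈ Λ`
  have reduce : ∀ {u v w : ℤ} (k m : ℤ), (u : A) + v * β + w * β ^ 2 ∈ Λ →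
      ((v - 2 * k : ℤ) : A) * β + ((w - 4 * m : ℤ) : A) * β ^ 2 ∈ Λ := by
    intro u v w k m hx
    have h := Λ.sub_mem (Λ.sub_mem (Λ.sub_mem hx (zmul u m1)) (zmul k m2β)) (zmul m m4sq)
    convert h using 1
    push_cast
    ring
  -- `β ∈ Λ` forces `Λ = Λ_1`
  have case1 : β ∈ Λ → Λ = span ℤ ({1, β, β ^ 2} : Set A) := fun hβm => by
    refine le_antisymm h₁ (span_le.2 ?_)
    rintro x (rfl | rfl | rfl)
    · exact m1
    · exact hβm
    · rw [pow_two]; exact mmul hβm hβm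
  -- `β + β² ∈ Λ` forces `β ∈ Λ` («`(β+β²)² = −2β − β² = −β − (β+β²)`, so `β ∈ Λ`»)
  have case_l1 : β + β ^ 2 ∈ Λ → β ∈ Λ := fun hy => by
    have hsq : (β + β ^ 2) * (β + β ^ 2) ∈ Λ := mmul hy hy
    have e : β = -((β + β ^ 2) * (β + β ^ 2)) - (β + β ^ 2) := by
      rw [← pow_two, sq_add_sq_eq hβ]; ring
    rw [e]
    exact Λ.sub_mem (Λ.neg_mem hsq) hy
  by_cases hodd : ∃ x ∈ Λ, ∃ u v w : ℤ, x = (u : A) + v * β + w * β ^ 2 ∧ ¬ 2 ∣ v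
  · -- second case of HL: some `β + lβ² ∈ Λ`
    left
    obtain ⟨x, hx, u, v, w, rfl, hv⟩ := hodd
    -- `β + (w mod 4)β² ∈ Λ`
    have hy : β + ((w % 4 : ℤ) : A) * β ^ 2 ∈ Λ := by
      have h := reduce (v / 2) (w / 4) hx
      have ev : v - 2 * (v / 2) = 1 := by omega
      have ew : w - 4 * (w / 4) = w % 4 := by omega
      rw [ev, ew] at h
      simpa using h
    apply case1
    have hw : w % 4 = 0 ∨ w % 4 = 1 ∨ w % 4 = 2 ∨ w % 4 = 3 := by omega
    rcases hw with hw | hw | hw | hw <;> rw [hw] at hy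
    · -- `l = 0`: `β ∈ Λ`
      simpa using hy
    · -- `l = 1`
      exact case_l1 (by simpa using hy)
    · -- `l = 2`: «`(β + 2β²)² = β² + 8`, so `β² ∈ Λ`, so `β ∈ Λ`»
      push_cast at hy
      have hsq : β ^ 2 ∈ Λ := by
        have h := Λ.sub_mem (mmul hy hy) (zmul 8 m1)
        rw [← pow_two, sq_add_two_sq_eq hβ] at h
        convert h using 1
        push_cast
        ring
      have h := Λ.sub_mem hy (zmul 2 hsq)
      convert h using 1
      push_cast
      ring
    · -- `l = 3`: «`β + 3β² = −(β + β²) + 2β + 4β²`, so `β + β² ∈ Λ`»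
      push_cast at hy
      refine case_l1 ?_
      have h := Λ.sub_mem (Λ.sub_mem hy m2β) m4sq
      rw [add_three_sq_eq] at h
      have e : -(β + β ^ 2) + 2 * β + 4 * β ^ 2 - 2 * β - 4 * β ^ 2 = -(β + β ^ 2) := by ring
      rw [e] at h
      simpa using Λ.neg_mem h
  · -- first case of HL: `Λ ∩ {β + lβ²} = ∅`; every element has an even `β`-coordinate
    push Not at hodd
    right
    -- coordinates of an element of `Λ`
    have coords : ∀ {x : A}, x ∈ Λ → ∃ u v w : ℤ, x = (u : A) + v * β + w * β ^ 2 ∧ 2 ∣ v ∧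
        (w : A) * β ^ 2 ∈ Λ := by
      intro x hx
      obtain ⟨a, b, c, habc⟩ := mem_span_triple.1 (h₁ hx)
      simp only [zsmul_eq_mul, mul_one] at habc
      have hv : 2 ∣ b := hodd x hx a b c habc.symm
      refine ⟨a, b, c, habc.symm, hv, ?_⟩
      have h := reduce (b / 2) 0 (habc ▸ hx)
      have ev : b - 2 * (b / 2) = 0 := by omega
      rw [ev] at h
      simpa using h
    by_cases hsq : β ^ 2 ∈ Λ
    · -- `Λ = Λ_2`
      left
      refine le_antisymm (fun x hx => ?_) (span_le.2 ?_)
      · obtain ⟨u, v, w, rfl, ⟨k, rfl⟩, -⟩ := coords hx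
        exact mem_span_triple_of_eq u k w (by push_cast; ring)
      · rintro x (rfl | rfl | rfl)
        · exact m1
        · exact m2β
        · exact hsq
    right
    by_cases h2sq : 2 * β ^ 2 ∈ Λ
    · -- `Λ = Λ_3`
      left
      refine le_antisymm (fun x hx => ?_) (span_le.2 ?_)
      · obtain ⟨u, v, w, rfl, ⟨k, rfl⟩, hw⟩ := coords hx
        have hw2 : 2 ∣ w := by
          by_contra hodd'
          apply hsq
          -- `β² = wβ² − ((w − 1)/2)·2β²`
          have h := Λ.sub_mem hw (zmul ((w - 1) / 2) h2sq)
          have e : (((w - 1) / 2 : ℤ) : A) * (2 * β ^ 2) = ((2 * ((w - 1) / 2) : ℤ) : A) * β ^ 2 := by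
            push_cast; ring
          have e2 : 2 * ((w - 1) / 2) = w - 1 := by omega
          rw [e, e2] at h
          convert h using 1
          push_cast
          ring
        obtain ⟨m, rfl⟩ := hw2
        exact mem_span_triple_of_eq u k m (by push_cast; ring)
      · rintro x (rfl | rfl | rfl)
        · exact m1
        · exact m2β
        · exact h2sq
    · -- `Λ = Λ_4`
      right
      refine le_antisymm (fun x hx => ?_) h₄
      obtain ⟨u, v, w, rfl, ⟨k, rfl⟩, hw⟩ := coords hx
      have hw4 : 4 ∣ w := by
        by_contra hnot
        rcases Int.emod_two_eq_zero_or_one w with he | ho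
        · -- `w ≡ 2 mod 4`: `2β² = wβ² − ((w − 2)/4)·4β² ∈ Λ`
          apply h2sq
          have h := Λ.sub_mem hw (zmul ((w - 2) / 4) m4sq)
          have e : (((w - 2) / 4 : ℤ) : A) * (4 * β ^ 2) = ((4 * ((w - 2) / 4) : ℤ) : A) * β ^ 2 := by
            push_cast; ring
          have e2 : 4 * ((w - 2) / 4) = w - 2 := by omega
          rw [e, e2] at h
          convert h using 1
          push_cast
          ring
        · -- `w` odd: `β² = w·(wβ²) − ((w² − 1)/4)·4β² ∈ Λ`
          apply hsq
          have h := Λ.sub_mem (zmul w hw) (zmul ((w * w - 1) / 4) m4sq)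
          have e : (((w * w - 1) / 4 : ℤ) : A) * (4 * β ^ 2) = ((4 * ((w * w - 1) / 4) : ℤ) : A) * β ^ 2 := by
            push_cast; ring
          have hsqodd : 4 ∣ w * w - 1 := by
            obtain ⟨j, hj⟩ : ∃ j, w = 2 * j + 1 := ⟨w / 2, by omega⟩
            exact ⟨j * j + j, by rw [hj]; ring⟩
          have e2 : 4 * ((w * w - 1) / 4) = w * w - 1 := by omega
          rw [e, e2] at h
          convert h using 1
          push_cast
          ring
      obtain ⟨m, rfl⟩ := hw4
      exact mem_span_triple_of_eq u k m (by push_cast; ring)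

/-! ## §5 The field of [DTZ62]: `A = ℚ[t]/(t³ + 2t² + 2t + 2)` -/

/-- In `A = ℚ[t]/(t³ + 2t² + 2t + 2)` the class `β = [t]` satisfies `β³ + 2β² + 2β + 2 = 0`.
[cite: HertlingLarabi2026b, §8 («`0 = β³ + 2β² + 2β + 2`»), chunk p0024] -/
theorem root_relation :
    (AdjoinRoot.root (Polynomial.X ^ 3 + Polynomial.C 2 * Polynomial.X ^ 2 + Polynomial.C 2 * Polynomial.X +
        Polynomial.C 2 : Polynomial ℚ)) ^ 3 +
      2 * (AdjoinRoot.root (Polynomial.X ^ 3 + Polynomial.C 2 * Polynomial.X ^ 2 + Polynomial.C 2 * Polynomial.X +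
        Polynomial.C 2 : Polynomial ℚ)) ^ 2 +
      2 * AdjoinRoot.root (Polynomial.X ^ 3 + Polynomial.C 2 * Polynomial.X ^ 2 + Polynomial.C 2 * Polynomial.X +
        Polynomial.C 2 : Polynomial ℚ) + 2 = 0 := by
  have h := AdjoinRoot.eval₂_root (Polynomial.X ^ 3 + Polynomial.C 2 * Polynomial.X ^ 2 +
    Polynomial.C 2 * Polynomial.X + Polynomial.C 2 : Polynomial ℚ)
  simp only [Polynomial.eval₂_add, Polynomial.eval₂_mul, Polynomial.eval₂_X_pow, Polynomial.eval₂_C,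
    Polynomial.eval₂_X] at h
  have e2 : (AdjoinRoot.of (Polynomial.X ^ 3 + Polynomial.C 2 * Polynomial.X ^ 2 + Polynomial.C 2 * Polynomial.X +
      Polynomial.C 2 : Polynomial ℚ)) 2 = 2 := map_ofNat _ 2
  rw [e2] at h
  exact h

/-- In `A = ℚ[t]/(t³ + 2t² + 2t + 2)` the power basis `1, β, β²` is `ℤ`-linearly independent (so §3 applies: the
four orders are different, and `u + vβ + wβ²` has well-defined coordinates). [cite: HertlingLarabi2026b, §8 («`Λ_1 = ⟨1, β, β²⟩_ℤ`»), chunk p0024] -/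
theorem linearIndependent_powers_root :
    LinearIndependent ℤ ![(1 : AdjoinRoot (Polynomial.X ^ 3 + Polynomial.C 2 * Polynomial.X ^ 2 +
        Polynomial.C 2 * Polynomial.X + Polynomial.C 2 : Polynomial ℚ)),
      AdjoinRoot.root (Polynomial.X ^ 3 + Polynomial.C 2 * Polynomial.X ^ 2 + Polynomial.C 2 * Polynomial.X +
        Polynomial.C 2 : Polynomial ℚ),
      AdjoinRoot.root (Polynomial.X ^ 3 + Polynomial.C 2 * Polynomial.X ^ 2 + Polynomial.C 2 * Polynomial.X +
        Polynomial.C 2 : Polynomial ℚ) ^ 2] := by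
  set g : Polynomial ℚ := Polynomial.X ^ 3 + Polynomial.C 2 * Polynomial.X ^ 2 + Polynomial.C 2 * Polynomial.X +
    Polynomial.C 2 with hg
  have hmonic : g.Monic := by rw [hg]; monicity!
  have hdeg : g.natDegree = 3 := by rw [hg]; compute_degree!
  set pb := AdjoinRoot.powerBasis' hmonic with hpb
  have hdim : pb.dim = 3 := by rw [hpb, AdjoinRoot.powerBasis'_dim, hdeg]
  -- the `ℚ`-basis `root^i`, reindexed by `Fin 3`
  have hli : LinearIndependent ℚ (fun i : Fin 3 => pb.basis (Fin.cast hdim.symm i)) :=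
    pb.basis.linearIndependent.comp _ (Fin.cast_injective _)
  have hfun : (fun i : Fin 3 => pb.basis (Fin.cast hdim.symm i)) = ![(1 : AdjoinRoot g), AdjoinRoot.root g,
      AdjoinRoot.root g ^ 2] := by
    have hgen : pb.gen = AdjoinRoot.root g := by rw [hpb, AdjoinRoot.powerBasis'_gen]
    funext i
    rw [pb.basis_eq_pow, hgen]
    fin_cases i <;> simp
  rw [hfun] at hli
  exact hli.restrict_scalars (fun a b h => by simpa using h)

/-- **LEMMA 8.1 in the field of [DTZ62]**: in `A = ℚ[t]/(t³ + 2t² + 2t + 2)`, `β = [t]`, a multiplicatively closed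
`ℤ`-submodule `Λ` with `⟨1, 2β, 4β²⟩ ⊆ Λ ⊆ ⟨1, β, β²⟩ = ℤ[β]` (`= Λ_max` by [LMFDB23], cited by HL) is one of the four
orders `Λ_1, Λ_2, Λ_3, Λ_4`, and these four are pairwise different.
[cite: HertlingLarabi2026b, §8 Lemma 8.1 with proof, chunk p0024] -/
theorem eq_of_isOrder_adjoinRoot
    {Λ : Submodule ℤ (AdjoinRoot (Polynomial.X ^ 3 + Polynomial.C 2 * Polynomial.X ^ 2 +
      Polynomial.C 2 * Polynomial.X + Polynomial.C 2 : Polynomial ℚ))}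
    (h₄ : span ℤ ({1, 2 * AdjoinRoot.root _, 4 * AdjoinRoot.root _ ^ 2} : Set _) ≤ Λ)
    (h₁ : Λ ≤ span ℤ ({1, AdjoinRoot.root _, AdjoinRoot.root _ ^ 2} : Set _)) (hmul : Λ * Λ ≤ Λ) :
    (Λ = span ℤ ({1, AdjoinRoot.root _, AdjoinRoot.root _ ^ 2} : Set _) ∨
      Λ = span ℤ ({1, 2 * AdjoinRoot.root _, AdjoinRoot.root _ ^ 2} : Set _) ∨
      Λ = span ℤ ({1, 2 * AdjoinRoot.root _, 2 * AdjoinRoot.root _ ^ 2} : Set _) ∨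
      Λ = span ℤ ({1, 2 * AdjoinRoot.root _, 4 * AdjoinRoot.root _ ^ 2} : Set _)) ∧
    (span ℤ ({1, AdjoinRoot.root _, AdjoinRoot.root _ ^ 2} : Set (AdjoinRoot (Polynomial.X ^ 3 +
        Polynomial.C 2 * Polynomial.X ^ 2 + Polynomial.C 2 * Polynomial.X + Polynomial.C 2 : Polynomial ℚ))) ≠
        span ℤ ({1, 2 * AdjoinRoot.root _, AdjoinRoot.root _ ^ 2} : Set _) ∧
      span ℤ ({1, 2 * AdjoinRoot.root _, AdjoinRoot.root _ ^ 2} : Set (AdjoinRoot (Polynomial.X ^ 3 +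
        Polynomial.C 2 * Polynomial.X ^ 2 + Polynomial.C 2 * Polynomial.X + Polynomial.C 2 : Polynomial ℚ))) ≠
        span ℤ ({1, 2 * AdjoinRoot.root _, 2 * AdjoinRoot.root _ ^ 2} : Set _) ∧
      span ℤ ({1, 2 * AdjoinRoot.root _, 2 * AdjoinRoot.root _ ^ 2} : Set (AdjoinRoot (Polynomial.X ^ 3 +
        Polynomial.C 2 * Polynomial.X ^ 2 + Polynomial.C 2 * Polynomial.X + Polynomial.C 2 : Polynomial ℚ))) ≠
        span ℤ ({1, 2 * AdjoinRoot.root _, 4 * AdjoinRoot.root _ ^ 2} : Set _) ∧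
      span ℤ ({1, AdjoinRoot.root _, AdjoinRoot.root _ ^ 2} : Set (AdjoinRoot (Polynomial.X ^ 3 +
        Polynomial.C 2 * Polynomial.X ^ 2 + Polynomial.C 2 * Polynomial.X + Polynomial.C 2 : Polynomial ℚ))) ≠
        span ℤ ({1, 2 * AdjoinRoot.root _, 4 * AdjoinRoot.root _ ^ 2} : Set _)) :=
  ⟨eq_of_isOrder_of_le_of_le root_relation h₄ h₁ hmul, span_ne linearIndependent_powers_root⟩

/-! ## §6 (row g41-#5) Coordinates of products; the lattice `L_3 = ⟨1, β, 2β²⟩`: `L_3² = Λ_1`, `𝒪(L_3) = Λ_3` -/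

/-- `(u + vβ + wβ²)·β = −2w + (u − 2w)β + (v − 2w)β²`. [cite: HertlingLarabi2026b, §8 («`0 = β³ + 2β² + 2β + 2`»), chunk p0024] -/
theorem coords_mul_root (hβ : β ^ 3 + 2 * β ^ 2 + 2 * β + 2 = 0) (u v w : ℤ) :
    ((u : A) + v * β + w * β ^ 2) * β =
      ((-2 * w : ℤ) : A) + ((u - 2 * w : ℤ) : A) * β + ((v - 2 * w : ℤ) : A) * β ^ 2 := by
  push_cast
  linear_combination (w : A) * hβ

/-- `(u + vβ + wβ²)·β² = (−2v + 4w) + (−2v + 2w)β + (u − 2v + 2w)β²`. [cite: HertlingLarabi2026b, §8, chunk p0024] -/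
theorem coords_mul_sq (hβ : β ^ 3 + 2 * β ^ 2 + 2 * β + 2 = 0) (u v w : ℤ) :
    ((u : A) + v * β + w * β ^ 2) * β ^ 2 =
      ((-2 * v + 4 * w : ℤ) : A) + ((-2 * v + 2 * w : ℤ) : A) * β + ((u - 2 * v + 2 * w : ℤ) : A) * β ^ 2 := by
  push_cast
  linear_combination ((v : A) + (w : A) * (β - 2)) * hβ

/-- Products of two triples of generators: nine memberships give `span·span ≤ I`. [folklore] -/
private theorem span_triple_mul_span_triple_le {p q r p' q' r' : A} {I : Submodule ℤ A}
    (h : ∀ a ∈ ({p, q, r} : Set A), ∀ b ∈ ({p', q', r'} : Set A), a * b ∈ I) :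
    span ℤ ({p, q, r} : Set A) * span ℤ ({p', q', r'} : Set A) ≤ I := by
  rw [span_mul_span, span_le]
  rintro x ⟨a, ha, b, hb, rfl⟩
  exact h a ha b hb

/-- Membership in `I / span{p, q, r}` is tested on the three generators. [folklore] -/
private theorem mem_div_span_triple_iff {I : Submodule ℤ A} {p q r x : A} :
    x ∈ I / span ℤ ({p, q, r} : Set A) ↔ x * p ∈ I ∧ x * q ∈ I ∧ x * r ∈ I := by
  constructor
  · intro h
    rw [mem_div_iff_forall_mul_mem] at h
    exact ⟨h p (subset_span (by simp)), h q (subset_span (by simp)), h r (subset_span (by simp))⟩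
  · rintro ⟨hp, hq, hr⟩
    rw [mem_div_iff_forall_mul_mem]
    intro y hy
    refine span_induction (p := fun y _ => x * y ∈ I) ?_ ?_ ?_ ?_ hy
    · intro y hy
      simp only [Set.mem_insert_iff, Set.mem_singleton_iff] at hy
      rcases hy with rfl | rfl | rfl
      · exact hp
      · exact hq
      · exact hr
    · rw [mul_zero]; exact I.zero_mem
    · intro y z _ _ hy hz
      rw [mul_add]; exact I.add_mem hy hz
    · intro n y _ hy
      rw [mul_smul_comm]; exact I.smul_mem n hy

/-- Elements of `Λ_1 = ⟨1, β, β²⟩` have integer coordinates. [cite: HertlingLarabi2026b, §8 («`Λ_1 = ⟨1, β, β²⟩_ℤ`»), chunk p0024] -/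
theorem exists_coords_of_mem_span₁ {x : A} (hx : x ∈ span ℤ ({1, β, β ^ 2} : Set A)) :
    ∃ u v w : ℤ, x = (u : A) + v * β + w * β ^ 2 := by
  obtain ⟨a, b, c, habc⟩ := mem_span_triple.1 hx
  exact ⟨a, b, c, by rw [← habc]; simp only [zsmul_eq_mul, mul_one]⟩

/-- `1 ∈ L_3 = ⟨1, β, 2β²⟩`. [cite: HertlingLarabi2026b, §8 (8.1), chunk p0025] -/
theorem one_mem_spanL₃ (β : A) : (1 : A) ∈ span ℤ ({1, β, 2 * β ^ 2} : Set A) := subset_span (by simp)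

/-- `L_3 ⊆ Λ_1`. [cite: HertlingLarabi2026b, §8 (8.1) («`L_3` satisfies `1 ∈ L_3 ⊊ Λ_1`»), chunk p0025] -/
theorem spanL₃_le_span₁ (β : A) : span ℤ ({1, β, 2 * β ^ 2} : Set A) ≤ span ℤ ({1, β, β ^ 2} : Set A) := by
  refine span_le.2 ?_
  rintro x (rfl | rfl | rfl)
  · exact subset_span (by simp)
  · exact subset_span (by simp)
  · exact mem_span_triple_of_eq 0 0 2 (by push_cast; ring)

/-- `u + vβ + wβ² ∈ L_3 = ⟨1, β, 2β²⟩ ⟺ 2 ∣ w`. [cite: HertlingLarabi2026b, §8 (8.1), chunk p0025] -/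
theorem mem_spanL₃_iff (hli : LinearIndependent ℤ ![(1 : A), β, β ^ 2]) (u v w : ℤ) :
    (u : A) + v * β + w * β ^ 2 ∈ span ℤ ({1, β, 2 * β ^ 2} : Set A) ↔ 2 ∣ w := by
  constructor
  · intro h
    obtain ⟨a, b, c, habc⟩ := mem_span_triple.1 h
    simp only [zsmul_eq_mul, mul_one] at habc
    obtain ⟨-, -, h3⟩ := coeff_eq_zero hli (a := a - u) (b := b - v) (c := 2 * c - w)
      (by push_cast; linear_combination habc)
    exact ⟨c, by omega⟩
  · rintro ⟨k, rfl⟩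
    exact mem_span_triple_of_eq u v k (by push_cast; ring)

/-- **`L_3² = Λ_1`** («`L_3` satisfies `1 ∈ L_3 ⊊ Λ_1` and `L_3² = Λ_1`, so `L_3` is not invertible by Lemma 4.6»,
Dedekind's observation). [cite: HertlingLarabi2026b, §8 (8.1) with Lemma 4.6, chunk p0025] -/
theorem spanL₃_mul_spanL₃ (hβ : β ^ 3 + 2 * β ^ 2 + 2 * β + 2 = 0) :
    span ℤ ({1, β, 2 * β ^ 2} : Set A) * span ℤ ({1, β, 2 * β ^ 2} : Set A) = span ℤ ({1, β, β ^ 2} : Set A) := by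
  refine le_antisymm ((mul_le_mul' (spanL₃_le_span₁ β) (spanL₃_le_span₁ β)).trans (span₁_mul_le hβ))
    (span_le.2 ?_)
  have h1 : (1 : A) ∈ span ℤ ({1, β, 2 * β ^ 2} : Set A) := subset_span (by simp)
  have hb : β ∈ span ℤ ({1, β, 2 * β ^ 2} : Set A) := subset_span (by simp)
  rintro x (rfl | rfl | rfl)
  · simpa using mul_mem_mul h1 h1
  · simpa using mul_mem_mul h1 hb
  · simpa [pow_two] using mul_mem_mul hb hb

/-- `β² ∉ L_3`, so `L_3 ⊊ L_3² = Λ_1` (when `1, β, β²` are `ℤ`-linearly independent).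
[cite: HertlingLarabi2026b, §8 (8.1) («`1 ∈ L_3 ⊊ Λ_1`»), chunk p0025] -/
theorem spanL₃_ne_span₁ (hli : LinearIndependent ℤ ![(1 : A), β, β ^ 2]) :
    span ℤ ({1, β, 2 * β ^ 2} : Set A) ≠ span ℤ ({1, β, β ^ 2} : Set A) := by
  intro e
  have h : β ^ 2 ∈ span ℤ ({1, β, 2 * β ^ 2} : Set A) := e ▸ subset_span (by simp)
  have := (mem_spanL₃_iff hli 0 0 1).1 (by simpa using h)
  omega

/-- **`𝒪(L_3) = Λ_3`** («One sees easily `𝒪(L_3) = Λ_3`»): `L_3 : L_3 = {x | xL_3 ⊆ L_3} = ⟨1, 2β, 2β²⟩` (when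
`1, β, β²` are `ℤ`-linearly independent). [cite: HertlingLarabi2026b, §8 after (8.1), chunk p0025] -/
theorem spanL₃_div_spanL₃ (hβ : β ^ 3 + 2 * β ^ 2 + 2 * β + 2 = 0)
    (hli : LinearIndependent ℤ ![(1 : A), β, β ^ 2]) :
    span ℤ ({1, β, 2 * β ^ 2} : Set A) / span ℤ ({1, β, 2 * β ^ 2} : Set A) =
      span ℤ ({1, 2 * β, 2 * β ^ 2} : Set A) := by
  refine le_antisymm (fun x hx => ?_) (le_div_iff_mul_le.2 ?_)
  · obtain ⟨h1, hb, -⟩ := mem_div_span_triple_iff.1 hx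
    rw [mul_one] at h1
    obtain ⟨u, v, w, rfl⟩ := exists_coords_of_mem_span₁ (spanL₃_le_span₁ β h1)
    have hw : 2 ∣ w := (mem_spanL₃_iff hli u v w).1 h1
    rw [coords_mul_root hβ] at hb
    have hv : 2 ∣ v - 2 * w := (mem_spanL₃_iff hli _ _ _).1 hb
    exact (mem_span₃_iff hli u v w).2 ⟨by omega, hw⟩
  · refine span_triple_mul_span_triple_le fun a ha b hb => ?_
    simp only [Set.mem_insert_iff, Set.mem_singleton_iff] at ha hb
    rcases ha with rfl | rfl | rfl <;> rcases hb with rfl | rfl | rfl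
    · -- (1β^0) * (1β^0)
      exact mem_span_triple_of_eq 1 0 0 (by push_cast; ring)
    · -- (1β^0) * (1β^1)
      exact mem_span_triple_of_eq 0 1 0 (by push_cast; ring)
    · -- (1β^0) * (2β^2)
      exact mem_span_triple_of_eq 0 0 1 (by push_cast; ring)
    · -- (2β^1) * (1β^0)
      exact mem_span_triple_of_eq 0 2 0 (by push_cast; ring)
    · -- (2β^1) * (1β^1)
      exact mem_span_triple_of_eq 0 0 1 (by push_cast; ring)
    · -- (2β^1) * (2β^2)
      exact mem_span_triple_of_eq (-8) (-8) (-4) (by push_cast; linear_combination ((-4 : A)) * hβ)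
    · -- (2β^2) * (1β^0)
      exact mem_span_triple_of_eq 0 0 1 (by push_cast; ring)
    · -- (2β^2) * (1β^1)
      exact mem_span_triple_of_eq (-4) (-4) (-2) (by push_cast; linear_combination ((-2 : A)) * hβ)
    · -- (2β^2) * (2β^2)
      exact mem_span_triple_of_eq 16 8 4 (by push_cast; linear_combination ((8 : A) + (-4 : A) * β) * hβ)

/-! ## §7 (row g41-#5) The unit `β + 1 = γ`: `(β+1)⁴ = −2β − 3`, and `(β+1)ᵏ ∈ Λ_2 ⟺ 2 ∣ k`, `(β+1)ᵏ ∈ Λ_3 ⟺ (β+1)ᵏ ∈ Λ_4 ⟺ 4 ∣ k` -/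

/-- `β + 1` is a unit of `ℤ[β]`: `(β + 1)·(−(β² + β + 1)) = 1` (HL: `Λ_max^{unit} = {±(β+1)ˡ | l ∈ ℤ}`, cited from
[LMFDB23]). [cite: HertlingLarabi2026b, §8 («`Λ_max^{unit} = {±(β+1)^l | l ∈ ℤ}`»), chunk p0024] -/
theorem add_one_mul_eq_one (hβ : β ^ 3 + 2 * β ^ 2 + 2 * β + 2 = 0) : (β + 1) * -(β ^ 2 + β + 1) = 1 := by
  linear_combination -hβ

/-- «`(β+1)² = β² + 2β + 1`». [cite: HertlingLarabi2026b, §8 («Observe …»), chunk p0025] -/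
theorem add_one_sq (β : A) : (β + 1) ^ 2 = ((1 : ℤ) : A) + ((2 : ℤ) : A) * β + ((1 : ℤ) : A) * β ^ 2 := by
  push_cast
  ring

/-- `(β+1)³ = −1 + β + β²`. [cite: HertlingLarabi2026b, §8 («Observe …»), chunk p0025] -/
theorem add_one_pow_three (hβ : β ^ 3 + 2 * β ^ 2 + 2 * β + 2 = 0) :
    (β + 1) ^ 3 = ((-1 : ℤ) : A) + ((1 : ℤ) : A) * β + ((1 : ℤ) : A) * β ^ 2 := by
  push_cast
  linear_combination hβ

/-- «`(β+1)⁴ = −2β − 3`». [cite: HertlingLarabi2026b, §8 («Observe … `(β+1)⁴ = −2β − 3 ∈ Λ_2, Λ_3, Λ_4`»), chunk p0025] -/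
theorem add_one_pow_four (hβ : β ^ 3 + 2 * β ^ 2 + 2 * β + 2 = 0) :
    (β + 1) ^ 4 = ((-3 : ℤ) : A) + ((-2 : ℤ) : A) * β + ((0 : ℤ) : A) * β ^ 2 := by
  push_cast
  linear_combination (β + 2) * hβ

/-- The inverse of `(β+1)⁴`: `(−2β − 3)·(4β² + 2β + 5) = 1`, and `4β² + 2β + 5 ∈ Λ_4`.
[cite: HertlingLarabi2026b, §8 («`Λ_3^{unit} = Λ_4^{unit} = {±(β+1)^{4l} | l ∈ ℤ}`»), chunk p0025] -/
theorem pow_four_mul_inv_eq_one (hβ : β ^ 3 + 2 * β ^ 2 + 2 * β + 2 = 0) :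
    (((-3 : ℤ) : A) + ((-2 : ℤ) : A) * β + ((0 : ℤ) : A) * β ^ 2) *
      (((5 : ℤ) : A) + ((2 : ℤ) : A) * β + ((4 : ℤ) : A) * β ^ 2) = 1 := by
  push_cast
  linear_combination (-8) * hβ

/-- Periodicity: for an order `Λ` containing `(β+1)⁴` and its inverse, `(β+1)^{k+4} ∈ Λ ⟺ (β+1)ᵏ ∈ Λ`. [folklore] -/
private theorem add_one_pow_add_four_mem_iff (hβ : β ^ 3 + 2 * β ^ 2 + 2 * β + 2 = 0) {Λ : Submodule ℤ A}
    (hmul : Λ * Λ ≤ Λ) (h4 : ((-3 : ℤ) : A) + ((-2 : ℤ) : A) * β + ((0 : ℤ) : A) * β ^ 2 ∈ Λ)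
    (hinv : ((5 : ℤ) : A) + ((2 : ℤ) : A) * β + ((4 : ℤ) : A) * β ^ 2 ∈ Λ) (k : ℕ) :
    (β + 1) ^ (k + 4) ∈ Λ ↔ (β + 1) ^ k ∈ Λ := by
  rw [pow_add, add_one_pow_four hβ]
  constructor
  · intro h
    have h' := hmul (mul_mem_mul h hinv)
    rwa [mul_assoc, pow_four_mul_inv_eq_one hβ, mul_one] at h'
  · intro h
    exact hmul (mul_mem_mul h h4)

/-- **`(β+1)ᵏ ∈ Λ_2 ⟺ 2 ∣ k`** («`Λ_2^{unit} = {±(β+1)^{2l}}`, `[Λ_1^{unit} : Λ_2^{unit}] = 2`» — here the membership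
half; that `Λ_1^{unit} = ±(β+1)^ℤ` is cited by HL from [LMFDB23]).
[cite: HertlingLarabi2026b, §8 («Observe `β+1 ∉ Λ_2`, `(β+1)² ∈ Λ_2`, `(β+1)³ ∉ Λ_2`, `(β+1)⁴ ∈ Λ_2`»), chunk p0025] -/
theorem add_one_pow_mem_span₂_iff (hβ : β ^ 3 + 2 * β ^ 2 + 2 * β + 2 = 0)
    (hli : LinearIndependent ℤ ![(1 : A), β, β ^ 2]) (k : ℕ) :
    (β + 1) ^ k ∈ span ℤ ({1, 2 * β, β ^ 2} : Set A) ↔ 2 ∣ k := by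
  induction k using Nat.strong_induction_on with
  | _ k ih =>
    rcases lt_or_ge k 4 with hk | hk
    · interval_cases k
      · simpa using one_mem_span₂ β
      · rw [pow_one, show β + 1 = ((1 : ℤ) : A) + ((1 : ℤ) : A) * β + ((0 : ℤ) : A) * β ^ 2 by push_cast; ring,
          mem_span₂_iff hli]
        norm_num
      · rw [add_one_sq, mem_span₂_iff hli]
        norm_num
      · rw [add_one_pow_three hβ, mem_span₂_iff hli]
        norm_num
    · obtain ⟨j, rfl⟩ : ∃ j, k = j + 4 := ⟨k - 4, by omega⟩
      rw [add_one_pow_add_four_mem_iff hβ (span₂_mul_le hβ) ((mem_span₂_iff hli _ _ _).2 (by norm_num))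
        ((mem_span₂_iff hli _ _ _).2 (by norm_num)), ih j (by omega)]
      omega

/-- **`(β+1)ᵏ ∈ Λ_3 ⟺ 4 ∣ k`** («`Λ_3^{unit} = {±(β+1)^{4l}}`, index `4`»).
[cite: HertlingLarabi2026b, §8 («`(β+1)² ∉ Λ_3`, `(β+1)⁴ ∈ Λ_3`»), chunk p0025] -/
theorem add_one_pow_mem_span₃_iff (hβ : β ^ 3 + 2 * β ^ 2 + 2 * β + 2 = 0)
    (hli : LinearIndependent ℤ ![(1 : A), β, β ^ 2]) (k : ℕ) :
    (β + 1) ^ k ∈ span ℤ ({1, 2 * β, 2 * β ^ 2} : Set A) ↔ 4 ∣ k := by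
  induction k using Nat.strong_induction_on with
  | _ k ih =>
    rcases lt_or_ge k 4 with hk | hk
    · interval_cases k
      · simpa using one_mem_span₃ β
      · rw [pow_one, show β + 1 = ((1 : ℤ) : A) + ((1 : ℤ) : A) * β + ((0 : ℤ) : A) * β ^ 2 by push_cast; ring,
          mem_span₃_iff hli]
        norm_num
      · rw [add_one_sq, mem_span₃_iff hli]
        norm_num
      · rw [add_one_pow_three hβ, mem_span₃_iff hli]
        norm_num
    · obtain ⟨j, rfl⟩ : ∃ j, k = j + 4 := ⟨k - 4, by omega⟩
      rw [add_one_pow_add_four_mem_iff hβ (span₃_mul_le hβ) ((mem_span₃_iff hli _ _ _).2 (by norm_num))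
        ((mem_span₃_iff hli _ _ _).2 (by norm_num)), ih j (by omega)]
      omega

/-- **`(β+1)ᵏ ∈ Λ_4 ⟺ 4 ∣ k`** («`Λ_4^{unit} = {±(β+1)^{4l}}`, index `4`»).
[cite: HertlingLarabi2026b, §8 («`(β+1)⁴ = −2β − 3 ∈ Λ_4`»), chunk p0025] -/
theorem add_one_pow_mem_span₄_iff (hβ : β ^ 3 + 2 * β ^ 2 + 2 * β + 2 = 0)
    (hli : LinearIndependent ℤ ![(1 : A), β, β ^ 2]) (k : ℕ) :
    (β + 1) ^ k ∈ span ℤ ({1, 2 * β, 4 * β ^ 2} : Set A) ↔ 4 ∣ k := by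
  induction k using Nat.strong_induction_on with
  | _ k ih =>
    rcases lt_or_ge k 4 with hk | hk
    · interval_cases k
      · simpa using one_mem_span₄ β
      · rw [pow_one, show β + 1 = ((1 : ℤ) : A) + ((1 : ℤ) : A) * β + ((0 : ℤ) : A) * β ^ 2 by push_cast; ring,
          mem_span₄_iff hli]
        norm_num
      · rw [add_one_sq, mem_span₄_iff hli]
        norm_num
      · rw [add_one_pow_three hβ, mem_span₄_iff hli]
        norm_num
    · obtain ⟨j, rfl⟩ : ∃ j, k = j + 4 := ⟨k - 4, by omega⟩
      rw [add_one_pow_add_four_mem_iff hβ (span₄_mul_le hβ) ((mem_span₄_iff hli _ _ _).2 (by norm_num))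
        ((mem_span₄_iff hli _ _ _).2 (by norm_num)), ih j (by omega)]
      omega

/-! ## §8 (row g41-#5) The conductors `Cᵢ = Λᵢ : Λ_1` -/

/-- **`C_2 = Λ_2 : Λ_1 = ⟨2, 2β, β²⟩`**. [cite: HertlingLarabi2026b, §8 («Observe `C_2 = ⟨2, 2β, β²⟩_ℤ`»), chunk p0025] -/
theorem span₂_div_span₁ (hβ : β ^ 3 + 2 * β ^ 2 + 2 * β + 2 = 0)
    (hli : LinearIndependent ℤ ![(1 : A), β, β ^ 2]) :
    span ℤ ({1, 2 * β, β ^ 2} : Set A) / span ℤ ({1, β, β ^ 2} : Set A) = span ℤ ({2, 2 * β, β ^ 2} : Set A) := by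
  refine le_antisymm (fun x hx => ?_) (le_div_iff_mul_le.2 ?_)
  · obtain ⟨h1, hb, -⟩ := mem_div_span_triple_iff.1 hx
    rw [mul_one] at h1
    obtain ⟨u, v, w, rfl⟩ := exists_coords_of_mem_span₁ (span₂_le_span₁ β h1)
    have hv : 2 ∣ v := (mem_span₂_iff hli u v w).1 h1
    rw [coords_mul_root hβ] at hb
    have hu : 2 ∣ u - 2 * w := (mem_span₂_iff hli _ _ _).1 hb
    obtain ⟨a, ha⟩ : 2 ∣ u := by omega
    obtain ⟨k, rfl⟩ := hv
    exact mem_span_triple_of_eq a k w (by rw [ha]; push_cast; ring)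
  · refine span_triple_mul_span_triple_le fun a ha b hb => ?_
    simp only [Set.mem_insert_iff, Set.mem_singleton_iff] at ha hb
    rcases ha with rfl | rfl | rfl <;> rcases hb with rfl | rfl | rfl
    · -- (2β^0) * (1β^0)
      exact mem_span_triple_of_eq 2 0 0 (by push_cast; ring)
    · -- (2β^0) * (1β^1)
      exact mem_span_triple_of_eq 0 1 0 (by push_cast; ring)
    · -- (2β^0) * (1β^2)
      exact mem_span_triple_of_eq 0 0 2 (by push_cast; ring)
    · -- (2β^1) * (1β^0)
      exact mem_span_triple_of_eq 0 1 0 (by push_cast; ring)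
    · -- (2β^1) * (1β^1)
      exact mem_span_triple_of_eq 0 0 2 (by push_cast; ring)
    · -- (2β^1) * (1β^2)
      exact mem_span_triple_of_eq (-4) (-2) (-4) (by push_cast; linear_combination ((-2 : A)) * hβ)
    · -- (1β^2) * (1β^0)
      exact mem_span_triple_of_eq 0 0 1 (by push_cast; ring)
    · -- (1β^2) * (1β^1)
      exact mem_span_triple_of_eq (-2) (-1) (-2) (by push_cast; linear_combination ((-1 : A)) * hβ)
    · -- (1β^2) * (1β^2)
      exact mem_span_triple_of_eq 4 1 2 (by push_cast; linear_combination ((2 : A) + (-1 : A) * β) * hβ)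

/-- **`C_3 = Λ_3 : Λ_1 = ⟨2, 2β, 2β²⟩`**. [cite: HertlingLarabi2026b, §8 («`C_3 = ⟨2, 2β, 2β²⟩_ℤ`»), chunk p0025] -/
theorem span₃_div_span₁ (hβ : β ^ 3 + 2 * β ^ 2 + 2 * β + 2 = 0)
    (hli : LinearIndependent ℤ ![(1 : A), β, β ^ 2]) :
    span ℤ ({1, 2 * β, 2 * β ^ 2} : Set A) / span ℤ ({1, β, β ^ 2} : Set A) =
      span ℤ ({2, 2 * β, 2 * β ^ 2} : Set A) := by
  refine le_antisymm (fun x hx => ?_) (le_div_iff_mul_le.2 ?_)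
  · obtain ⟨h1, hb, -⟩ := mem_div_span_triple_iff.1 hx
    rw [mul_one] at h1
    obtain ⟨u, v, w, rfl⟩ := exists_coords_of_mem_span₁ (span₂_le_span₁ β (span₃_le_span₂ β h1))
    obtain ⟨hv, hw⟩ := (mem_span₃_iff hli u v w).1 h1
    rw [coords_mul_root hβ] at hb
    obtain ⟨hu, -⟩ := (mem_span₃_iff hli _ _ _).1 hb
    obtain ⟨a, ha⟩ : 2 ∣ u := by omega
    obtain ⟨k, rfl⟩ := hv
    obtain ⟨m, rfl⟩ := hw
    exact mem_span_triple_of_eq a k m (by rw [ha]; push_cast; ring)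
  · refine span_triple_mul_span_triple_le fun a ha b hb => ?_
    simp only [Set.mem_insert_iff, Set.mem_singleton_iff] at ha hb
    rcases ha with rfl | rfl | rfl <;> rcases hb with rfl | rfl | rfl
    · -- (2β^0) * (1β^0)
      exact mem_span_triple_of_eq 2 0 0 (by push_cast; ring)
    · -- (2β^0) * (1β^1)
      exact mem_span_triple_of_eq 0 1 0 (by push_cast; ring)
    · -- (2β^0) * (1β^2)
      exact mem_span_triple_of_eq 0 0 1 (by push_cast; ring)
    · -- (2β^1) * (1β^0)
      exact mem_span_triple_of_eq 0 1 0 (by push_cast; ring)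
    · -- (2β^1) * (1β^1)
      exact mem_span_triple_of_eq 0 0 1 (by push_cast; ring)
    · -- (2β^1) * (1β^2)
      exact mem_span_triple_of_eq (-4) (-2) (-2) (by push_cast; linear_combination ((-2 : A)) * hβ)
    · -- (2β^2) * (1β^0)
      exact mem_span_triple_of_eq 0 0 1 (by push_cast; ring)
    · -- (2β^2) * (1β^1)
      exact mem_span_triple_of_eq (-4) (-2) (-2) (by push_cast; linear_combination ((-2 : A)) * hβ)
    · -- (2β^2) * (1β^2)
      exact mem_span_triple_of_eq 8 2 2 (by push_cast; linear_combination ((4 : A) + (-2 : A) * β) * hβ)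

/-- **`C_4 = Λ_4 : Λ_1 = ⟨4, 4β, 4β²⟩ = 4Λ_1`**. [cite: HertlingLarabi2026b, §8 («`C_4 = ⟨4, 4β, 4β²⟩_ℤ`»), chunk p0025] -/
theorem span₄_div_span₁ (hβ : β ^ 3 + 2 * β ^ 2 + 2 * β + 2 = 0)
    (hli : LinearIndependent ℤ ![(1 : A), β, β ^ 2]) :
    span ℤ ({1, 2 * β, 4 * β ^ 2} : Set A) / span ℤ ({1, β, β ^ 2} : Set A) =
      span ℤ ({4, 4 * β, 4 * β ^ 2} : Set A) := by
  refine le_antisymm (fun x hx => ?_) (le_div_iff_mul_le.2 ?_)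
  · obtain ⟨h1, hb, hsq⟩ := mem_div_span_triple_iff.1 hx
    rw [mul_one] at h1
    obtain ⟨u, v, w, rfl⟩ := exists_coords_of_mem_span₁
      (span₂_le_span₁ β (span₃_le_span₂ β (span₄_le_span₃ β h1)))
    obtain ⟨hv, hw⟩ := (mem_span₄_iff hli u v w).1 h1
    rw [coords_mul_root hβ] at hb
    obtain ⟨hu, hv'⟩ := (mem_span₄_iff hli _ _ _).1 hb
    rw [coords_mul_sq hβ] at hsq
    obtain ⟨-, hu'⟩ := (mem_span₄_iff hli _ _ _).1 hsq
    obtain ⟨a, rfl⟩ : 4 ∣ u := by omega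
    obtain ⟨k, rfl⟩ : 4 ∣ v := by omega
    obtain ⟨m, rfl⟩ := hw
    exact mem_span_triple_of_eq a k m (by push_cast; ring)
  · refine span_triple_mul_span_triple_le fun a ha b hb => ?_
    simp only [Set.mem_insert_iff, Set.mem_singleton_iff] at ha hb
    rcases ha with rfl | rfl | rfl <;> rcases hb with rfl | rfl | rfl
    · -- (4β^0) * (1β^0)
      exact mem_span_triple_of_eq 4 0 0 (by push_cast; ring)
    · -- (4β^0) * (1β^1)
      exact mem_span_triple_of_eq 0 2 0 (by push_cast; ring)
    · -- (4β^0) * (1β^2)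
      exact mem_span_triple_of_eq 0 0 1 (by push_cast; ring)
    · -- (4β^1) * (1β^0)
      exact mem_span_triple_of_eq 0 2 0 (by push_cast; ring)
    · -- (4β^1) * (1β^1)
      exact mem_span_triple_of_eq 0 0 1 (by push_cast; ring)
    · -- (4β^1) * (1β^2)
      exact mem_span_triple_of_eq (-8) (-4) (-2) (by push_cast; linear_combination ((-4 : A)) * hβ)
    · -- (4β^2) * (1β^0)
      exact mem_span_triple_of_eq 0 0 1 (by push_cast; ring)
    · -- (4β^2) * (1β^1)
      exact mem_span_triple_of_eq (-8) (-4) (-2) (by push_cast; linear_combination ((-4 : A)) * hβ)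
    · -- (4β^2) * (1β^2)
      exact mem_span_triple_of_eq 16 4 2 (by push_cast; linear_combination ((8 : A) + (-4 : A) * β) * hβ)

/-! ## §9 (row g41-#5) The invertible lattice `L_4 = ⟨2, 2β, 2β² + 1⟩` (8.2): `𝒪(L_4) = Λ_4`; the six matrices -/

/-- `u + vβ + wβ² ∈ L_4 = ⟨2, 2β, 2β² + 1⟩ ⟺ 2 ∣ v` and `w = 2c` with `u ≡ c (mod 2)`.
[cite: HertlingLarabi2026b, §8 (8.2), chunk p0025] -/
theorem mem_spanL₄_iff (hli : LinearIndependent ℤ ![(1 : A), β, β ^ 2]) (u v w : ℤ) :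
    (u : A) + v * β + w * β ^ 2 ∈ span ℤ ({2, 2 * β, 2 * β ^ 2 + 1} : Set A) ↔
      2 ∣ v ∧ ∃ c : ℤ, w = 2 * c ∧ 2 ∣ u - c := by
  constructor
  · intro h
    obtain ⟨a, b, c, habc⟩ := mem_span_triple.1 h
    simp only [zsmul_eq_mul] at habc
    obtain ⟨h1, h2, h3⟩ := coeff_eq_zero hli (a := 2 * a + c - u) (b := 2 * b - v) (c := 2 * c - w)
      (by push_cast; linear_combination habc)
    exact ⟨⟨b, by omega⟩, c, by omega, ⟨a, by omega⟩⟩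
  · rintro ⟨⟨k, rfl⟩, c, rfl, ⟨a, ha⟩⟩
    have hu : u = 2 * a + c := by omega
    rw [hu]
    exact mem_span_triple_of_eq a k c (by push_cast; ring)

/-- **`𝒪(L_4) = Λ_4`**: `L_4 : L_4 = ⟨1, 2β, 4β²⟩` (HL: `L_4` is invertible with `G([Λ_4]_ε) = {[Λ_4]_ε, [L_4]_ε}`).
[cite: HertlingLarabi2026b, §8 (8.2) and the table of `ε`-classes, chunk p0025] -/
theorem spanL₄_div_spanL₄ (hβ : β ^ 3 + 2 * β ^ 2 + 2 * β + 2 = 0)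
    (hli : LinearIndependent ℤ ![(1 : A), β, β ^ 2]) :
    span ℤ ({2, 2 * β, 2 * β ^ 2 + 1} : Set A) / span ℤ ({2, 2 * β, 2 * β ^ 2 + 1} : Set A) =
      span ℤ ({1, 2 * β, 4 * β ^ 2} : Set A) := by
  have hL₄₁ : span ℤ ({2, 2 * β, 2 * β ^ 2 + 1} : Set A) ≤ span ℤ ({1, β, β ^ 2} : Set A) := by
    refine span_le.2 ?_
    rintro x (rfl | rfl | rfl)
    · exact mem_span_triple_of_eq 2 0 0 (by push_cast; ring)
    · exact mem_span_triple_of_eq 0 2 0 (by push_cast; ring)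
    · exact mem_span_triple_of_eq 1 0 2 (by push_cast; ring)
  refine le_antisymm (fun x hx => ?_) (le_div_iff_mul_le.2 ?_)
  · obtain ⟨h2, h2b, h2s⟩ := mem_div_span_triple_iff.1 hx
    -- `x = x(2β² + 1) − (x·2)β² ∈ Λ_1`
    have hx1 : x ∈ span ℤ ({1, β, β ^ 2} : Set A) := by
      have h : x * (2 * β ^ 2 + 1) - x * 2 * β ^ 2 ∈ span ℤ ({1, β, β ^ 2} : Set A) := by
        refine Submodule.sub_mem _ (hL₄₁ h2s) (span₁_mul_le hβ (mul_mem_mul (hL₄₁ h2) ?_))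
        exact subset_span (by simp)
      have e : x * (2 * β ^ 2 + 1) - x * 2 * β ^ 2 = x := by ring
      rwa [e] at h
    obtain ⟨u, v, w, rfl⟩ := exists_coords_of_mem_span₁ hx1
    -- the three conditions
    have e2 : ((u : A) + v * β + w * β ^ 2) * 2 = ((2 * u : ℤ) : A) + ((2 * v : ℤ) : A) * β +
        ((2 * w : ℤ) : A) * β ^ 2 := by push_cast; ring
    rw [e2] at h2
    obtain ⟨-, c, hc, hc'⟩ := (mem_spanL₄_iff hli _ _ _).1 h2
    have e2b : ((u : A) + v * β + w * β ^ 2) * (2 * β) = ((-4 * w : ℤ) : A) + ((2 * u - 4 * w : ℤ) : A) * β +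
        ((2 * v - 4 * w : ℤ) : A) * β ^ 2 := by push_cast; linear_combination (2 * (w : A)) * hβ
    rw [e2b] at h2b
    obtain ⟨-, c', hc2, hc2'⟩ := (mem_spanL₄_iff hli _ _ _).1 h2b
    have e2s : ((u : A) + v * β + w * β ^ 2) * (2 * β ^ 2 + 1) = ((u - 4 * v + 8 * w : ℤ) : A) +
        ((-3 * v + 4 * w : ℤ) : A) * β + ((2 * u - 4 * v + 5 * w : ℤ) : A) * β ^ 2 := by
      push_cast; linear_combination (2 * (v : A) + 2 * (w : A) * (β - 2)) * hβ
    rw [e2s] at h2s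
    obtain ⟨-, c'', hc3, hc3'⟩ := (mem_spanL₄_iff hli _ _ _).1 h2s
    exact (mem_span₄_iff hli u v w).2 ⟨by omega, by omega⟩
  · refine span_triple_mul_span_triple_le fun a ha b hb => ?_
    simp only [Set.mem_insert_iff, Set.mem_singleton_iff] at ha hb
    rcases ha with rfl | rfl | rfl <;> rcases hb with rfl | rfl | rfl
    · -- (1β^0) * (2β^0)
      exact mem_span_triple_of_eq 1 0 0 (by push_cast; ring)
    · -- (1β^0) * (2β^1)
      exact mem_span_triple_of_eq 0 1 0 (by push_cast; ring)
    · -- (1β^0) * (1β^0 + 2β^2)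
      exact mem_span_triple_of_eq 0 0 1 (by push_cast; ring)
    · -- (2β^1) * (2β^0)
      exact mem_span_triple_of_eq 0 2 0 (by push_cast; ring)
    · -- (2β^1) * (2β^1)
      exact mem_span_triple_of_eq (-1) 0 2 (by push_cast; ring)
    · -- (2β^1) * (1β^0 + 2β^2)
      exact mem_span_triple_of_eq (-2) (-3) (-4) (by push_cast; linear_combination ((-4 : A)) * hβ)
    · -- (4β^2) * (2β^0)
      exact mem_span_triple_of_eq (-2) 0 4 (by push_cast; ring)
    · -- (4β^2) * (2β^1)
      exact mem_span_triple_of_eq (-4) (-8) (-8) (by push_cast; linear_combination ((-8 : A)) * hβ)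
    · -- (4β^2) * (1β^0 + 2β^2)
      exact mem_span_triple_of_eq 11 8 10 (by push_cast; linear_combination ((16 : A) + (-8 : A) * β) * hβ)

/-- **(8.2)**: `L_4 = C_4 + (1 + 2β²)Λ_4`, i.e. `⟨4, 4β, 4β²⟩ + ⟨1+2β², (1+2β²)2β, (1+2β²)4β²⟩ = ⟨2, 2β, 2β²+1⟩` as
`ℤ`-submodules. [cite: HertlingLarabi2026b, §8 (8.2) («`a := 1 + 2β²` works and gives `L_4 = C_4 + aΛ_4 = ⟨2, 2β, 2β²+1⟩_ℤ`»), chunk p0025] -/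
theorem span_C₄_sup_eq_spanL₄ (hβ : β ^ 3 + 2 * β ^ 2 + 2 * β + 2 = 0) :
    span ℤ ({4, 4 * β, 4 * β ^ 2} : Set A) ⊔
        span ℤ ({1 + 2 * β ^ 2, (1 + 2 * β ^ 2) * (2 * β), (1 + 2 * β ^ 2) * (4 * β ^ 2)} : Set A) =
      span ℤ ({2, 2 * β, 2 * β ^ 2 + 1} : Set A) := by
  refine le_antisymm (sup_le (span_le.2 ?_) (span_le.2 ?_)) (span_le.2 ?_)
  · rintro x (rfl | rfl | rfl)
    · exact mem_span_triple_of_eq 2 0 0 (by push_cast; ring)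
    · exact mem_span_triple_of_eq 0 2 0 (by push_cast; ring)
    · exact mem_span_triple_of_eq (-1) 0 2 (by push_cast; ring)
  · rintro x (rfl | rfl | rfl)
    · exact mem_span_triple_of_eq 0 0 1 (by push_cast; ring)
    · exact mem_span_triple_of_eq (-2) (-3) (-4) (by push_cast; linear_combination (-4 : A) * hβ)
    · exact mem_span_triple_of_eq 11 8 10 (by push_cast; linear_combination ((16 : A) + (-8 : A) * β) * hβ)
  · rintro x (rfl | rfl | rfl)
    · exact Submodule.mem_sup.2 ⟨-(4 * β ^ 2), neg_mem (subset_span (by simp)), 2 * (1 + 2 * β ^ 2),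
        mem_span_triple_of_eq 2 0 0 (by push_cast; ring), by ring⟩
    · exact Submodule.mem_sup.2 ⟨8 + 8 * β + 8 * β ^ 2, mem_span_triple_of_eq 2 2 2 (by push_cast; ring),
        (1 + 2 * β ^ 2) * (2 * β), subset_span (by simp), by linear_combination 4 * hβ⟩
    · exact Submodule.mem_sup.2 ⟨0, zero_mem _, 1 + 2 * β ^ 2, subset_span (by simp), by ring⟩

/-- **The six matrices of §8** («`M_L ∈ M_{3×3}(ℤ)` with `2β·𝓑_L = 𝓑_L·M_L` […] representatives of the six
`GL_3(ℤ)`-conjugacy classes of integer matrices with characteristic polynomial `t³ + 4t² + 8t + 16`»): the columns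
of `M_L` are the coordinates of `2β·b` for `b` running through the `ℤ`-basis `𝓑_L` — verified here as identities in
`ℤ[β]` for all six bases `(1, β, β²)`, `(1, 2β, β²)`, `(1, 2β, 2β²)`, `(1, β, 2β²)`, `(1, 2β, 4β²)`, `(2, 2β, 2β²+1)`.
[cite: HertlingLarabi2026b, §8 (end: the matrices `M_{Λ_1}, …, M_{L_4}`), chunk p0025] -/
theorem two_mul_root_mul_basis (hβ : β ^ 3 + 2 * β ^ 2 + 2 * β + 2 = 0) :
    -- `M_{Λ_1} = (0 0 −4; 2 0 −4; 0 2 −4)` in the basis `(1, β, β²)`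
    (2 * β * 1 = 0 * 1 + 2 * β + 0 * β ^ 2 ∧ 2 * β * β = 0 * 1 + 0 * β + 2 * β ^ 2 ∧
      2 * β * β ^ 2 = -4 * 1 + -4 * β + -4 * β ^ 2) ∧
    -- `M_{Λ_2} = (0 0 −4; 1 0 −2; 0 4 −4)` in the basis `(1, 2β, β²)`
    (2 * β * 1 = 0 * 1 + 1 * (2 * β) + 0 * β ^ 2 ∧ 2 * β * (2 * β) = 0 * 1 + 0 * (2 * β) + 4 * β ^ 2 ∧
      2 * β * β ^ 2 = -4 * 1 + -2 * (2 * β) + -4 * β ^ 2) ∧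
    -- `M_{Λ_3} = (0 0 −8; 1 0 −4; 0 2 −4)` in the basis `(1, 2β, 2β²)`
    (2 * β * 1 = 0 * 1 + 1 * (2 * β) + 0 * (2 * β ^ 2) ∧
      2 * β * (2 * β) = 0 * 1 + 0 * (2 * β) + 2 * (2 * β ^ 2) ∧
      2 * β * (2 * β ^ 2) = -8 * 1 + -4 * (2 * β) + -4 * (2 * β ^ 2)) ∧
    -- `M_{L_3} = (0 0 −8; 2 0 −8; 0 1 −4)` in the basis `(1, β, 2β²)`
    (2 * β * 1 = 0 * 1 + 2 * β + 0 * (2 * β ^ 2) ∧ 2 * β * β = 0 * 1 + 0 * β + 1 * (2 * β ^ 2) ∧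
      2 * β * (2 * β ^ 2) = -8 * 1 + -8 * β + -4 * (2 * β ^ 2)) ∧
    -- `M_{Λ_4} = (0 0 −16; 1 0 −8; 0 1 −4)` in the basis `(1, 2β, 4β²)`
    (2 * β * 1 = 0 * 1 + 1 * (2 * β) + 0 * (4 * β ^ 2) ∧
      2 * β * (2 * β) = 0 * 1 + 0 * (2 * β) + 1 * (4 * β ^ 2) ∧
      2 * β * (4 * β ^ 2) = -16 * 1 + -8 * (2 * β) + -4 * (4 * β ^ 2)) ∧
    -- `M_{L_4} = (0 −1 −2; 2 0 −3; 0 2 −4)` in the basis `(2, 2β, 2β²+1)`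
    (2 * β * 2 = 0 * 2 + 2 * (2 * β) + 0 * (2 * β ^ 2 + 1) ∧
      2 * β * (2 * β) = -1 * 2 + 0 * (2 * β) + 2 * (2 * β ^ 2 + 1) ∧
      2 * β * (2 * β ^ 2 + 1) = -2 * 2 + -3 * (2 * β) + -4 * (2 * β ^ 2 + 1)) := by
  refine ⟨⟨by ring, by ring, by linear_combination 2 * hβ⟩, ⟨by ring, by ring, by linear_combination 2 * hβ⟩,
    ⟨by ring, by ring, by linear_combination 4 * hβ⟩, ⟨by ring, by ring, by linear_combination 4 * hβ⟩,
    ⟨by ring, by ring, by linear_combination 8 * hβ⟩, ⟨by ring, by ring, by linear_combination 4 * hβ⟩⟩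

/-- … and the six matrices all have characteristic polynomial `t³ + 4t² + 8t + 16` (the polynomial of `α = 2β`).
[cite: HertlingLarabi2026b, §8 (end), chunk p0025] -/
theorem charpoly_six_matrices :
    (!![0, 0, -4; 2, 0, -4; 0, 2, -4] : Matrix (Fin 3) (Fin 3) ℤ).charpoly =
        Polynomial.X ^ 3 + 4 * Polynomial.X ^ 2 + 8 * Polynomial.X + 16 ∧
      (!![0, 0, -4; 1, 0, -2; 0, 4, -4] : Matrix (Fin 3) (Fin 3) ℤ).charpoly =
        Polynomial.X ^ 3 + 4 * Polynomial.X ^ 2 + 8 * Polynomial.X + 16 ∧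
      (!![0, 0, -8; 1, 0, -4; 0, 2, -4] : Matrix (Fin 3) (Fin 3) ℤ).charpoly =
        Polynomial.X ^ 3 + 4 * Polynomial.X ^ 2 + 8 * Polynomial.X + 16 ∧
      (!![0, 0, -8; 2, 0, -8; 0, 1, -4] : Matrix (Fin 3) (Fin 3) ℤ).charpoly =
        Polynomial.X ^ 3 + 4 * Polynomial.X ^ 2 + 8 * Polynomial.X + 16 ∧
      (!![0, 0, -16; 1, 0, -8; 0, 1, -4] : Matrix (Fin 3) (Fin 3) ℤ).charpoly =
        Polynomial.X ^ 3 + 4 * Polynomial.X ^ 2 + 8 * Polynomial.X + 16 ∧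
      (!![0, -1, -2; 2, 0, -3; 0, 2, -4] : Matrix (Fin 3) (Fin 3) ℤ).charpoly =
        Polynomial.X ^ 3 + 4 * Polynomial.X ^ 2 + 8 * Polynomial.X + 16 := by
  refine ⟨?_, ?_, ?_, ?_, ?_, ?_⟩ <;>
  · rw [Matrix.charpoly, Matrix.det_fin_three]
    simp
    ring

end Literature.NumberTheory.ComplexMultiplication.FiniteQAlgebraLattice.DTZCubic
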